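import Summits.ValiantsHypothesis.ValiantsHypothesis.Theorems.BarrierLeverChowHitsThinRowPartitionMinorsRLabels

/-!
# Route BarrierLever — item `ChowHitsThinRowPartitionMinorsR` (stmt-ValiantsHypothesis-21850, budget
# `h·h`): columns with a FULL monomial basis — every thin layout on them is hit

Helper file (`--supports stmt-ValiantsHypothesis-21850`; cell valiant-natproofs, rung V4, 𝒟-side;
seat val-np-p5 gen 28).  Closes NO item; definition-free; imports this seat's `…RLabels`.

**Theorem `chowHitsHH_of_singletonBasis`.**  If the columns `w` admit an injective down-closed
monomial basis `U` (`det [U i ⊆ w j] ≠ 0`) containing EVERY singleton `{c}`, `c : Fin h` — i.e. the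
affine functions `1, z_1, …, z_h` are linearly independent on the column points, the column family
has affine defect `0` — then EVERY thin layout `(u, w)` (`u` injective of size `≤ 2`, any number of
singleton and pair rows) is hit by `h·h` affine forms, at every height.  Proof: relabel the rows by a
permutation so that the empty row carries `∅` and every singleton row `{a}` carries its own label
`{a}` (`Finset.exists_equiv_extend_of_card_eq`); then the label forms of `chowHitsHH_of_labels` are
the `h` singleton forms and the budget is `h + 2·#pairs ≤ h + 2·C(h,2) = h·h`.

WHAT THIS IS NOT: item 21850 is NOT proved (column families of positive affine defect with nearly
all thin rows remain); nothing on items 21882 / 19717, on crux stmt-ValiantsHypothesis-14610, or on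
`VP` versus `VNP`.
-/

set_option linter.dupNamespace false

namespace Summit.ValiantsHypothesis.ValiantsHypothesis.Theorems.BarrierLever.ChowThinHH

open Finset MvPolynomial

variable {h r : ℕ}

/-- The number of pair rows of an injective thin layout is at most `C(h,2)`. -/
theorem card_pairRows_le (u : Fin r → Finset (Fin h)) (hu : Function.Injective u) :
    (Finset.univ.filter fun i : Fin r => (u i).card = 2).card ≤ h.choose 2 := by
  classical
  rw [← Finset.card_image_of_injective _ hu]
  have hsub : (Finset.univ.filter fun i : Fin r => (u i).card = 2).image u ⊆
      (Finset.univ : Finset (Fin h)).powersetCard 2 := by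
    intro S hS
    obtain ⟨i, hi, rfl⟩ := Finset.mem_image.mp hS
    exact Finset.mem_powersetCard.mpr ⟨Finset.subset_univ _, (Finset.mem_filter.mp hi).2⟩
  refine (Finset.card_le_card hsub).trans ?_
  rw [Finset.card_powersetCard, Finset.card_univ, Fintype.card_fin]

/-- `h + 2·C(h,2) = h·h`. -/
theorem add_two_mul_choose_two (h : ℕ) : h + 2 * h.choose 2 = h * h := by
  rw [Nat.choose_two_right, Nat.mul_div_cancel' (Nat.even_mul_pred_self h).two_dvd]
  rcases h with _ | n
  · simp
  · rw [Nat.add_sub_cancel]; ring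

/-- **Columns with a full monomial basis: every thin layout is hit by `h·h` affine forms.** -/
theorem chowHitsHH_of_singletonBasis (h r : ℕ) (u w : Fin r → Finset (Fin h))
    (hu : Function.Injective u) (hu2 : ∀ i, (u i).card ≤ 2)
    (U : Fin r → Finset (Fin h)) (hUinj : Function.Injective U)
    (hUdown : ∀ i (S : Finset (Fin h)), S ⊆ U i → ∃ i', U i' = S)
    (hZ : (Matrix.of fun i j : Fin r => if U i ⊆ w j then (1 : ℂ) else 0).det ≠ 0)
    (hUsing : ∀ c : Fin h, ∃ i, U i = {c}) :
    ∃ ℓ : Fin (h * h) → MvPolynomial (Fin (h + h)) ℂ, (∀ k, (ℓ k).totalDegree ≤ 1) ∧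
      (Matrix.of fun i j : Fin r => MvPolynomial.coeff
        (∑ a ∈ u i, Finsupp.single (Fin.castAdd h a) 1 +
          ∑ c ∈ w j, Finsupp.single (Fin.natAdd h c) 1) (∏ k, ℓ k)).det ≠ 0 := by
  classical
  -- Step 1: every row of size `≤ 1` is itself a label
  have hlab : ∀ i, (u i).card ≤ 1 → ∃ i', U i' = u i := by
    intro i hi
    rcases Nat.lt_or_ge (u i).card 1 with h0 | h1
    · have hui : u i = ∅ := Finset.card_eq_zero.mp (by omega)
      obtain ⟨i', hi'⟩ := hUdown i ∅ (Finset.empty_subset _)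
      exact ⟨i', hi'.trans hui.symm⟩
    · obtain ⟨a, ha⟩ := Finset.card_eq_one.mp (le_antisymm hi h1)
      obtain ⟨i', hi'⟩ := hUsing a
      exact ⟨i', hi'.trans ha.symm⟩
  -- Step 2: a permutation sending each row of size `≤ 1` to the index of its own label
  set C : Finset (Fin r) := Finset.univ.filter fun i : Fin r => (u i).card ≤ 1 with hC
  set f : Fin r → Fin r := fun i => if hx : ∃ i', U i' = u i then Classical.choose hx else i with hf
  have hfU : ∀ i ∈ C, U (f i) = u i := by
    intro i hi
    have hx : ∃ i', U i' = u i := hlab i (Finset.mem_filter.mp hi).2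
    have e : f i = Classical.choose hx := by simp only [hf, dif_pos hx]
    rw [e]
    exact Classical.choose_spec hx
  have hinj : Set.InjOn f C := by
    intro i hi i' hi' e
    apply hu
    rw [← hfU i hi, ← hfU i' hi', e]
  obtain ⟨g, hg⟩ := Finset.exists_equiv_extend_of_card_eq (t := (Finset.univ : Finset (Fin r)))
    (by simp) (s := C) (f := f) (Finset.subset_univ _) hinj
  set π : Fin r ≃ Fin r := g.trans (Equiv.subtypeUnivEquiv Finset.mem_univ) with hπ
  have hπC : ∀ i ∈ C, π i = f i := by
    intro i hi
    rw [← hg i hi]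
    rfl
  -- Step 3: the relabelling `U' = U ∘ π`
  set U' : Fin r → Finset (Fin h) := fun i => U (π i) with hU'
  have hU'C : ∀ i ∈ C, U' i = u i := fun i hi => by
    show U (π i) = u i
    rw [hπC i hi, hfU i hi]
  have hU'inj : Function.Injective U' := hUinj.comp π.injective
  have hU'down : ∀ i (S : Finset (Fin h)), S ⊆ U' i → ∃ i', U' i' = S := by
    intro i S hS
    obtain ⟨i', hi'⟩ := hUdown (π i) S hS
    exact ⟨π.symm i', by simp only [hU', Equiv.apply_symm_apply, hi']⟩
  have hU'empty : ∀ i, u i = ∅ → U' i = ∅ := by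
    intro i hi
    have hiC : i ∈ C := Finset.mem_filter.mpr ⟨Finset.mem_univ _, by rw [hi]; simp⟩
    rw [hU'C i hiC, hi]
  have hZ' : (Matrix.of fun i j : Fin r => if U' i ⊆ w j then (1 : ℂ) else 0).det ≠ 0 := by
    have e : (Matrix.of fun i j : Fin r => if U' i ⊆ w j then (1 : ℂ) else 0) =
        (Matrix.of fun i j : Fin r => if U i ⊆ w j then (1 : ℂ) else 0).submatrix π id := by
      ext i j
      rfl
    rw [e, Matrix.det_permute]
    refine mul_ne_zero ?_ hZ
    rcases Int.units_eq_one_or (Equiv.Perm.sign π) with h1 | h1 <;> simp [h1]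
  -- Step 4: the budget `h + 2·#pairs ≤ h·h`
  refine chowHitsHH_of_labels h r u w hu hu2 U' hU'inj hU'down hU'empty hZ' ?_
  have himg : (Finset.univ.filter fun i : Fin r => (u i).card = 1).image U' ∪
      Finset.univ.image (fun c : Fin h => ({c} : Finset (Fin h))) =
      Finset.univ.image (fun c : Fin h => ({c} : Finset (Fin h))) := by
    refine Finset.union_eq_right.mpr fun S hS => ?_
    obtain ⟨i, hi, rfl⟩ := Finset.mem_image.mp hS
    have hi1 : (u i).card = 1 := (Finset.mem_filter.mp hi).2
    have hiC : i ∈ C := Finset.mem_filter.mpr ⟨Finset.mem_univ _, by omega⟩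
    obtain ⟨a, ha⟩ := Finset.card_eq_one.mp hi1
    rw [hU'C i hiC, ha]
    exact Finset.mem_image.mpr ⟨a, Finset.mem_univ _, rfl⟩
  rw [himg]
  have h1 : (Finset.univ.image (fun c : Fin h => ({c} : Finset (Fin h)))).card ≤ h :=
    Finset.card_image_le.trans (by rw [Finset.card_univ, Fintype.card_fin])
  have h2 := card_pairRows_le u hu
  have h3 := add_two_mul_choose_two h
  nlinarith

end Summit.ValiantsHypothesis.ValiantsHypothesis.Theorems.BarrierLever.ChowThinHH
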